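import Summits.ResolutionOfSingularities.ResolutionOfSingularities.Theorems.HomologicalConductorNoZenoRQuadraticTransformGlobalStep
import HarnessLib

/-!
# Crux `NoZenoR` (stmt-ResolutionOfSingularities-19943) — the centre of the global inductive step IS the reduced point:
# a desingularization of a stage factors through THE BLOWING UP OF THE POINT `w`

Route `ResolutionOfSingularities/HomologicalConductor` (cell decomp-res, hand leafhand-res-homologicalconduct-21 g0).
OURS: AI-written proof over tree theorems, weaker than expert review; nothing here is a statement of the manuscript
under review (Hironaka 2017).  SUPPORT level, counted 0.  Def-free, FACT-FREE.

`…NoZenoRQuadraticTransformGlobalStep.exists_isResolution_fac_blowup_of_stage` blows up a centre `𝓙` on the stage `W`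
that is only known to be cosupported in `{w}` with `𝓙·𝒪_{Spec 𝒪_{W,w}} = 𝔪̃_w`.  Here the centre is identified:

* `map_maximalIdeal_eq_of_bijective` — a bijective ring map of local rings carries `𝔪` onto `𝔪`;
* `stalkIdeal_affineBlowupIdealSheaf_maximalIdeal_closedPoint` — the stalk of `𝔪̃` at the closed point of `Spec R`
  (`R` local) is the maximal ideal of `𝒪_{Spec R, 𝔪} ≅ R`;
* **`eq_vanishingIdeal_of_comap_fromSpecStalk_eq`** — an ideal sheaf cosupported in the closed point `{w}` whose
  restriction to `Spec 𝒪_{W,w}` is `𝔪̃_w` IS the ideal sheaf `𝓘_w` of the reduced point (equal stalks everywhere: the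
  stalk map of the pro-open immersion `Spec 𝒪_{W,w} → W` at the closed point is an isomorphism,
  `isIso_stalkMap_of_flat_of_isPreimmersion`; tree `le_of_forall_stalkIdeal_le`);
* **`isEffectiveCartier_comap_vanishingIdeal_of_stage`**, **`exists_isResolution_fac_pointBlowup_of_stage`** — Lipman's
  inductive step literally: for a stage `g : W → Spec S` of a rational `Spec S` (integral, birational of finite type),
  a resolution `σ : X → W` and a closed non-regular normal point `w` of dimension two, `𝓘_w·𝒪_X` is an effective
  Cartier divisor and `σ` factors through EVERY blowing up `b : W₂ → W` of the point `w` (`IsBlowup b 𝓘_w`), the factor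
  being a resolution of `W₂` ("blow up a singular point … (*) shows that every desingularization dominates", p. 204).

No crux, kill test or summit statement is proved here; resolution in positive characteristic is NOT proved.

References: J. Lipman, Publ. Math. IHÉS 36 (1969), Theorem (4.1), proof (pp. 204–205); §2 (*) (p. 203) [`Lipman1969`];
M. Temkin, Adv. Math. 219 (2008), §2.1 [`Temkin2008`].
-/

noncomputable section

-- single-problem summit: the doubled namespace component `ResolutionOfSingularities` is forced
set_option linter.dupNamespace false

open CategoryTheory CategoryTheory.Limits AlgebraicGeometry TopologicalSpace Opposite IsLocalRing
open Literature.AlgebraicGeometry.Morphisms Literature.AlgebraicGeometry.Modules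
open Literature.AlgebraicGeometry.Resolution

namespace Summit.ResolutionOfSingularities.ResolutionOfSingularities.Theorems.NoZeno.QuadraticTransform

/-- A bijective ring homomorphism of local rings carries the maximal ideal onto the maximal ideal. [folklore] -/
theorem map_maximalIdeal_eq_of_bijective {A B : Type*} [CommRing A] [CommRing B] [IsLocalRing A] [IsLocalRing B]
    (f : A →+* B) (hf : Function.Bijective f) : (maximalIdeal A).map f = maximalIdeal B := by
  let e : A ≃+* B := RingEquiv.ofBijective f hf
  have he : ∀ a, e a = f a := fun _ => rfl
  apply le_antisymm
  · rw [Ideal.map_le_iff_le_comap]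
    intro a ha
    rw [Ideal.mem_comap, IsLocalRing.mem_maximalIdeal, mem_nonunits_iff, ← he, isUnit_map_iff e a]
    exact ha
  · intro b hb
    obtain ⟨a, rfl⟩ := hf.2 b
    refine Ideal.mem_map_of_mem _ ?_
    rw [IsLocalRing.mem_maximalIdeal, mem_nonunits_iff] at hb ⊢
    rwa [← he, isUnit_map_iff e a] at hb

/-- The stalk of `𝔪̃ = affineBlowup.idealSheaf 𝔪` at the closed point of `Spec R` (`R` local) is the maximal ideal of the
local ring `𝒪_{Spec R, 𝔪}` (`≅ R`, Mathlib `stalkClosedPointIso`). [folklore] -/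
theorem stalkIdeal_affineBlowupIdealSheaf_maximalIdeal_closedPoint (R : Type) [CommRing R] [IsLocalRing R] :
    stalkIdeal (affineBlowup.idealSheaf (maximalIdeal R)) (closedPoint R) =
      maximalIdeal ((Spec (.of R)).presheaf.stalk (closedPoint R)) := by
  rw [ExcCount.stalkIdeal_affineBlowupIdealSheaf]
  have hcomp : ((Spec (.of R)).presheaf.germ ⊤ (closedPoint R) trivial).hom.comp (Scheme.ΓSpecIso (.of R)).inv.hom =
      (stalkClosedPointIso (.of R)).inv.hom := by
    rw [← ΓSpecIso_hom_stalkClosedPointIso_inv, CommRingCat.hom_comp, RingHom.comp_assoc,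
      ← CommRingCat.hom_comp, Iso.inv_hom_id, CommRingCat.hom_id, RingHom.comp_id]
  rw [hcomp]
  exact map_maximalIdeal_eq_of_bijective _
    (ConcreteCategory.bijective_of_isIso (C := CommRingCat) (stalkClosedPointIso (.of R)).inv)

variable {W : Scheme.{0}}

/-- **An ideal sheaf cosupported in the closed point `w` and restricting to `𝔪̃_w` on `Spec 𝒪_{W,w}` is the ideal sheaf
of the reduced point `w`.** [cite: Temkin2008, §2.1 (p. 6)] -/
theorem eq_vanishingIdeal_of_comap_fromSpecStalk_eq (w : W) (hwc : IsClosed ({w} : Set W)) {J : W.IdealSheafData}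
    (hJsupp : (J.support : Set W) ⊆ {w})
    (hJ : J.comap (W.fromSpecStalk w) = affineBlowup.idealSheaf (maximalIdeal (W.presheaf.stalk w))) :
    J = Scheme.IdealSheafData.vanishingIdeal ⟨{w}, hwc⟩ := by
  -- the stalk at `w`: transported along the pro-open immersion `Spec 𝒪_{W,w} → W`
  have hw : stalkIdeal J w = maximalIdeal (W.presheaf.stalk w) := by
    set ι := W.fromSpecStalk w with hιdef
    set c := closedPoint (W.presheaf.stalk w) with hcdef
    haveI := flat_fromSpecStalk W w
    haveI := isIso_stalkMap_of_flat_of_isPreimmersion ι c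
    have hbij := ConcreteCategory.bijective_of_isIso (C := CommRingCat) (ι.stalkMap c)
    have hkey : stalkIdeal J (ι c) = maximalIdeal (W.presheaf.stalk (ι c)) := by
      have h1 : (stalkIdeal J (ι c)).map (ι.stalkMap c).hom =
          maximalIdeal ((Spec (W.presheaf.stalk w)).presheaf.stalk c) := by
        rw [← stalkIdeal_comap_eq_map_stalkMap, hJ]
        exact stalkIdeal_affineBlowupIdealSheaf_maximalIdeal_closedPoint (W.presheaf.stalk w)
      have h2 : (maximalIdeal (W.presheaf.stalk (ι c))).map (ι.stalkMap c).hom =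
          maximalIdeal ((Spec (W.presheaf.stalk w)).presheaf.stalk c) :=
        map_maximalIdeal_eq_of_bijective _ hbij
      rw [← Ideal.comap_map_of_bijective (ι.stalkMap c).hom hbij (I := stalkIdeal J (ι c)), h1, ← h2,
        Ideal.comap_map_of_bijective (ι.stalkMap c).hom hbij]
    have hc : ι c = w := Scheme.fromSpecStalk_closedPoint
    rw [hc] at hkey
    exact hkey
  -- compare stalks everywhere
  apply le_antisymm
  · refine le_of_forall_stalkIdeal_le fun x => ?_
    by_cases hx : x = w
    · subst hx
      rw [hw, stalkIdeal_vanishingIdeal_singleton]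
    · rw [stalkIdeal_eq_top_of_not_mem_support (I := Scheme.IdealSheafData.vanishingIdeal ⟨{w}, hwc⟩) ?_]
      · exact le_top
      · rw [← SetLike.mem_coe, Scheme.IdealSheafData.coe_support_vanishingIdeal]
        simpa using hx
  · refine le_of_forall_stalkIdeal_le fun x => ?_
    by_cases hx : x = w
    · subst hx
      rw [hw, stalkIdeal_vanishingIdeal_singleton]
    · rw [stalkIdeal_eq_top_of_not_mem_support (I := J) fun h => hx (hJsupp h)]
      exact le_top

variable {S : Type} [CommRing S] [IsNoetherianRing S] [IsLocalRing S] [IsDomain S] [IsIntegrallyClosed S]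
  [IsIntegral W] (g : W ⟶ Spec (.of S)) [LocallyOfFiniteType g] [QuasiCompact g]
  [IsSeparated g] {X : Scheme.{0}} (σ : X ⟶ W)

/-- **`𝓘_w·𝒪_X` is an effective Cartier divisor** for a resolution `σ : X → W` of a stage of a rational `Spec S` and a
closed non-regular normal point `w` of dimension two. [cite: Lipman1969, Theorem (4.1), proof (p. 204); Section 2, (*) (p. 203)] -/
theorem isEffectiveCartier_comap_vanishingIdeal_of_stage [IsNoetherian W] [IsNoetherian X]
    (hdim : ringKrullDim S = 2) (hrat : HasRationalSingularity S) (hg : IsBirational g) (hσ : IsResolution σ)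
    (w : W) (hwc : IsClosed ({w} : Set W)) (hw : IsIntegrallyClosed (W.presheaf.stalk w))
    (hw2 : ringKrullDim (W.presheaf.stalk w) = 2) (hwsing : ¬ IsRegularLocalRing (W.presheaf.stalk w)) :
    IsEffectiveCartier ((Scheme.IdealSheafData.vanishingIdeal ⟨{w}, hwc⟩).comap σ) := by
  obtain ⟨J, hJsupp, hJ, -, hcart⟩ :=
    exists_centre_isEffectiveCartier_comap_of_stage g σ hdim hrat hg hσ w hwc hw hw2 hwsing
  rw [← eq_vanishingIdeal_of_comap_fromSpecStalk_eq w hwc hJsupp hJ]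
  exact hcart

/-- **Lipman's inductive step, literally: `σ` factors through every blowing up of `W` at the point `w`, and the factor
is a resolution of the new stage.** [cite: Lipman1969, Theorem (4.1), proof (pp. 204–205); Section 2, (*) (p. 203)] -/
theorem exists_isResolution_fac_pointBlowup_of_stage [IsNoetherian W] [IsNoetherian X]
    (hdim : ringKrullDim S = 2) (hrat : HasRationalSingularity S) (hg : IsBirational g) (hσ : IsResolution σ)
    (w : W) (hwc : IsClosed ({w} : Set W)) (hw : IsIntegrallyClosed (W.presheaf.stalk w))
    (hw2 : ringKrullDim (W.presheaf.stalk w) = 2) (hwsing : ¬ IsRegularLocalRing (W.presheaf.stalk w))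
    {W₂ : Scheme.{0}} {b : W₂ ⟶ W} (hb : IsBlowup b (Scheme.IdealSheafData.vanishingIdeal ⟨{w}, hwc⟩)) :
    ∃ τ : X ⟶ W₂, τ ≫ b = σ ∧ IsResolution τ := by
  have hcart := isEffectiveCartier_comap_vanishingIdeal_of_stage g σ hdim hrat hg hσ w hwc hw hw2 hwsing
  have hI0 : Scheme.IdealSheafData.vanishingIdeal ⟨{w}, hwc⟩ ≠ ⊥ := by
    intro h
    have hmem : genericPoint W ∈ ((Scheme.IdealSheafData.vanishingIdeal (X := W) ⟨{w}, hwc⟩).support : Set W) := by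
      rw [h, Scheme.IdealSheafData.support_bot]; trivial
    rw [Scheme.IdealSheafData.coe_support_vanishingIdeal] at hmem
    exact ne_genericPoint_of_ringKrullDim_stalk_eq_two hw2 (Set.mem_singleton_iff.mp hmem).symm
  obtain ⟨τ, hτ, hprop, hbir⟩ := hσ.exists_factor_of_isEffectiveCartier_comap hI0 hb hcart
  exact ⟨τ, hτ, ⟨hprop, hbir, hσ.isRegular⟩⟩

end Summit.ResolutionOfSingularities.ResolutionOfSingularities.Theorems.NoZeno.QuadraticTransform

end
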